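import Summits.Ventures.PercRepro.RankLevelSetRuleQCellFiveSliceFour
import Summits.Ventures.PercRepro.RankLevelSetRuleQCellFiveSliceFive
import Summits.Ventures.PercRepro.RankLevelSetRuleQCellFiveSliceSix
import Summits.Ventures.PercRepro.RankLevelSetRuleQCellFiveSliceSeven
import Summits.Ventures.PercRepro.RankLevelSetRuleQCellFiveSliceEight
import Summits.Ventures.PercRepro.RankLevelSetRuleQCellSixSliceFive
import Summits.Ventures.PercRepro.RankLevelSetRuleQCellSixSliceSix
import Summits.Ventures.PercRepro.RankLevelSetRuleQCellSixSliceSeven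
import Summits.Ventures.PercRepro.RankLevelSetRuleQCellSixSliceEight
import Summits.Ventures.PercRepro.RankLevelSetRuleQCellSevenSliceSix
import Summits.Ventures.PercRepro.RankLevelSetRuleQCellSevenSliceSeven
import Summits.Ventures.PercRepro.RankLevelSetRuleQCellSevenSliceEight
import Summits.Ventures.PercRepro.RankLevelSetRuleQCellEightSliceSeven
import Summits.Ventures.PercRepro.RankLevelSetRuleQCellEightSliceEight
import Summits.Ventures.PercRepro.RankLevelSetRuleQCellNineSliceEight
import Summits.Ventures.PercRepro.RankLevelSetRuleQCellFiveSliceNine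
import Summits.Ventures.PercRepro.RankLevelSetRuleQCellSixSliceNine
import Summits.Ventures.PercRepro.RankLevelSetRuleQCellSevenSliceNine
import Summits.Ventures.PercRepro.RankLevelSetRuleQCellEightSliceNine
import Summits.Ventures.PercRepro.RankLevelSetRuleQCellNineSliceNine
import Summits.Ventures.PercRepro.RankLevelSetRuleQCellTenSliceNine
import Summits.Ventures.PercRepro.RankLevelSetRuleQBorderline
import Summits.Ventures.PercRepro.RankLevelSetRuleQCellEnds
import Summits.Ventures.PercRepro.RankLevelSetRuleQSliceOne

/-!
# PercRepro — THE STAIRCASE: THE SLICES `k − 1 ≤ u ≤ 9` OF EVERY CELL `(q+k, q)`, `5 ≤ k ≤ 10`, IN ONE STATEMENT; THE MAP OF `k = 5`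
(night-1, gen 18; dossier §29)

* **`rhat_staircase`** — `Φ(q+k, q) ≤ R̂(q, k, q − u)` for every `5 ≤ k ≤ 10`, `k − 1 ≤ u ≤ 9` and `q ≥ u` (the twenty-one slice
  theorems `rhat_five_slice_four_all … rhat_ten_slice_nine_all` bundled);
* **`rhat_five_map`** — the family `k = 5`: every slice `u = q − #P ≤ 9` except `u = 2` is paid on every cell
  (`u ∈ {0, 1}`: `rhatCell_self` / `rhatCell_pred`; `u = 3`: the borderline; `u = 4 … 9`: the staircase), and
  **`rhat_five_slice_iff`** — among the slices `u ≤ 9` a slice is paid on EVERY cell exactly when `u ≠ 2`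
  (`rhat_five_lt_phiK`: `u = 2` fails from `q = 1002`);
* **`ruleQRecv_ge_phiK_staircase`** — the matroid level: at the tight layer `#E = (q+k) + q` of every finite matroid, every member `Z`
  of the cell `(q+k, q)` with `#(flatPart M Z) = q − u`, `k − 1 ≤ u ≤ 9`, receives at least `Φ(q+k, q)` under Rule Q's equal split.
Axioms: standard.
-/

namespace PercRepro

open Set Matroid Finset

/-- **The staircase for `5 ≤ k ≤ 10`, `k − 1 ≤ u ≤ 9`**: `Φ(q+k, q) ≤ R̂(q, k, q − u)` for every `q ≥ u`. -/
theorem rhat_staircase (k u q : ℕ) (hk5 : 5 ≤ k) (hk10 : k ≤ 10) (hku : k - 1 ≤ u) (hu9 : u ≤ 9) (hq : u ≤ q) :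
    phiK (q + k) q ≤ rhat q k (q - u) := by
  interval_cases k
  · interval_cases u
    · exact rhat_five_slice_four_all q hq
    · exact rhat_five_slice_five_all q hq
    · exact rhat_five_slice_six_all q hq
    · exact rhat_five_slice_seven_all q hq
    · exact rhat_five_slice_eight_all q hq
    · exact rhat_five_slice_nine_all q hq
  · interval_cases u
    · exact rhat_six_slice_five_all q hq
    · exact rhat_six_slice_six_all q hq
    · exact rhat_six_slice_seven_all q hq
    · exact rhat_six_slice_eight_all q hq
    · exact rhat_six_slice_nine_all q hq
  · interval_cases u
    · exact rhat_seven_slice_six_all q hq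
    · exact rhat_seven_slice_seven_all q hq
    · exact rhat_seven_slice_eight_all q hq
    · exact rhat_seven_slice_nine_all q hq
  · interval_cases u
    · exact rhat_eight_slice_seven_all q hq
    · exact rhat_eight_slice_eight_all q hq
    · exact rhat_eight_slice_nine_all q hq
  · interval_cases u
    · exact rhat_nine_slice_eight_all q hq
    · exact rhat_nine_slice_nine_all q hq
  · interval_cases u
    exact rhat_ten_slice_nine_all q hq

/-- **The map of the family `k = 5` up to `u = 9`**: every slice `u = q − #P ≤ 9` other than `u = 2` is paid on every cell `(q+5, q)`. -/
theorem rhat_five_map (u q : ℕ) (hu9 : u ≤ 9) (hu2 : u ≠ 2) (hq : u ≤ q) :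
    phiK (q + 5) q ≤ rhat q 5 (q - u) := by
  rcases Nat.lt_or_ge u 4 with hlt | hge
  · interval_cases u
    · rw [Nat.sub_zero]; exact rhatCell_self q 5 (by norm_num)
    · exact rhatCell_pred q 5 hq (by norm_num)
    · exact absurd rfl hu2
    · exact rhat_five_slice_three_all q hq
  · exact rhat_staircase 5 u q (by norm_num) (by norm_num) (by omega) hu9 hq

/-- **The slices `u ≤ 9` of the family `k = 5`, exactly**: Rule Q's equal split pays the slice `u = q − #P` on EVERY cell `(q+5, q)`
if and only if `u ≠ 2` (`u = 2` fails from `q = 1002` on: `rhat_five_lt_phiK`). -/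
theorem rhat_five_slice_iff (u : ℕ) (hu9 : u ≤ 9) :
    (∀ q, u ≤ q → phiK (q + 5) q ≤ rhat q 5 (q - u)) ↔ u ≠ 2 := by
  constructor
  · intro h hu2
    subst hu2
    have h1 := h 1002 (by norm_num)
    have h2 := rhat_five_lt_phiK 1000 (le_refl _)
    rw [show (1002 : ℕ) - 2 = 1000 by norm_num] at h1
    exact absurd (lt_of_lt_of_le h2 h1) (lt_irrefl _)
  · intro hu2 q hq
    exact rhat_five_map u q hu9 hu2 hq

variable {α : Type} (M : Matroid α) [M.Finite]

/-- **The matroid level of the staircase**: at the tight layer of the cell `(q+k, q)`, `5 ≤ k ≤ 9`, every member `Z` with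
`#(flatPart M Z) = q − u`, `k − 1 ≤ u ≤ 9`, receives at least `Φ(q+k, q)` under Rule Q's equal split. -/
theorem ruleQRecv_ge_phiK_staircase {q k u : ℕ} (hk5 : 5 ≤ k) (hk10 : k ≤ 10) (hku : k - 1 ≤ u) (hu9 : u ≤ 9) (hq : u ≤ q)
    (hE : M.E.ncard = (q + k) + q) {Z : Set α} (hZ : Z ∈ cellMembers M (q + k) q)
    (hP : (flatPart M Z).ncard = q - u) :
    phiK (q + k) q ≤ ruleQRecv M (q + k) q Z := by
  have h1 := rhat_staircase k u q hk5 hk10 hku hu9 hq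
  have h2 := rhat_le_ruleQRecv M hE hZ
  rw [hP] at h2
  exact h1.trans h2

end PercRepro
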